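import Summits.BirchSwinnertonDyer.BirchSwinnertonDyer.Theorems.AdditiveRankOneHalvesOfFlatInclusions
import Summits.BirchSwinnertonDyer.BirchSwinnertonDyer.Theorems.AdditiveRankOneRowKernelsOddTwist
import Summits.BirchSwinnertonDyer.Rank1Residual.Additive.X4RankZeroKatoBoundTamagawaExact
import Summits.BirchSwinnertonDyer.Rank1Residual.GaloisImage.JWitnessTowerSurjectivity
import Summits.BirchSwinnertonDyer.Rank1Residual.AdditivePotMult.RankOneHeegner
import Summits.BirchSwinnertonDyer.Rank1Residual.AdditivePotMult.TwistSupplyJ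
import Summits.BirchSwinnertonDyer.Rank1Residual.X11b.TwistTransportRam
import HarnessLib

/-!
# BSD_p in analytic rank ONE on the TOWER-SURJECTIVE potentially supersingular rows (any odd additive `p`): the twist's
# r = 0 UPPER half is Kato's Tamagawa-exact bound, so the r = 1 LOWER half needs ONLY the Eisenstein ♭-inclusion, and
# BSD_p needs only the ♭-IMC equality + the twist's r = 0 LOWER half (K9 19200 `WildRankOne` / KT 19984 `TameRankOne`)

Prover seat `bsd-potss-kmc`, gen 20 (cell `bsd-potss`; row B8 «O7-ss»), 2026-08-27. HONEST FRAMING: CONDITIONAL on every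
displayed hypothesis; 0 definitions, 0 named facts minted, 0 `sorry`; closes nothing; BSD_p for no curve.

On the rows with `ρ_{E,p^n}` onto `GL₂(ℤ/p^n)` for every `n` (tower surjectivity; at `p ≥ 5` = `ρ̄_{E,p}` onto by Serre,
at `p = 3` = onto mod `9`), the quadratic twist `E^{(d_K)}` by a Heegner discriminant is again additive potentially good
at `p` with the same `j` and the same tower (`AdditivePotMult.addv_iff_of_twist`, `AdditivePotMult.j_of_model_twist`,
`hasSurjectiveModNGaloisRep_pow_iff_of_model_twist`; `d_K ∈ (ℚ_p^×)²` since `p ∣ N` splits in `K`), so its r = 0 UPPER half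
`MissingUpperBoundAt` is the tree theorem `X4RankZero.missingUpperBoundAt_of_katoTam` modulo Kato's Tamagawa-exact reading
A161″ (`Kato2004.rankZero_padicValNat_sha_add_padicValNat_tamagawa_le_of_additive_potGood_of_imageContainsSL2`, cite-level,
the input of K9's closed glue 19192) + GZK + modularity (§1). Feeding it to gen 20's half kernels
(`Theorems/AdditiveRankOneHalvesOfFlatInclusions.lean`, `…RowKernelsOddTwist.lean`) and control theorem (`…AdditivePotSupersingularControlOfFacts.lean`):

* §2 **`missingLowerBoundAt_potSS_towerSurj_of_flatEisenstein_of_katoTam_of_facts`** `(p) (R)` — on the rows `R W`,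
  `ClassO5 W p ∨ ClassO6 W p`, tower-surjective, `r_an = 1`: the r = 1 LOWER half `MissingLowerBoundAt W p` ⟸ the
  EISENSTEIN ♭-inclusion `Ch_Λ(X_(∅,0) at 𝔭′)·𝓞_{ℂ_p}⟦T⟧ ⊆ (Q)` on the class rows (X — the ONE research input; at the wild `3`
  = route SOED's crux `WildSplitEisensteinInclusionAtThree` in ♭-currency) ∧ A161″ ∧ {Poitou–Tate ×2, local Euler–Poincaré,
  cd ≤ 2, Brink Thm 2 / Cor 1, Serre 1967} ∧ Hsieh ∧ LZZ ∧ ToricPublishedInputs.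
* §3 **`bsdp_potSS_towerSurj_of_flatIMCEq_of_twistLower_of_katoTam_of_facts`** `(p) (R)` — same rows: `BSD_p(W)` ⟸ the
  ♭-IMC EQUALITY on the class rows ∧ the r = 0 LOWER half `MissingLowerBoundAt` of the class rows' twists (K9 L₀ / KT L₀ —
  research) ∧ the same named facts; and `bsdp_potSS_towerSurj_of_flatEisenstein_of_kolyvagin_of_twistLower_…` — X +
  a Manin-robust Kolyvagin index bound (Ko) in place of the equality.

NET for the K9/KT tenure (wild X4 tower-onto rank-one rows; tame (t′)/(G)∧ss X4 tower-onto rank-one rows): the LOWER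
half of 19200/19984 is ONE analytic statement (X, ♭) away from print; BSD_p on those rows is {IMC♭-eq or X + Ko} + the
r = 0 LOWER half of the twist away from print. No `p`-adic height, no signed Selmer condition, no twin.

References: [Kato2004Asterisque] Thm. 14.5 (3), Prop. 14.16 (2), §14.8; [GreenbergLNM1716] Prop. 4.13; [GrossZagier1986]
I.(6.3), Thm. I.7.3; [JetchevSkinnerWan2017] §7.4.1, Thm. 3.3.1; [Hsieh2014] Thm A; [LiuZhangZhang2018] Thm 1.5.1/1.5.3;
[SilvermanAEC2009] X.5 Cor. 5.4; [Serre1973] II §3.3 Thm. 3; [Brink2007] Thm 2, Cor 1; [Serre1967GroupesPDivisibles] §5 Prop. 8.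
-/

noncomputable section

open scoped Classical

set_option linter.dupNamespace false
set_option autoImplicit false

namespace Summit.BirchSwinnertonDyer.BirchSwinnertonDyer.Theorems.UniversalToricDescentWaldspurgerFlat

open WeierstrassCurve NumberField IsDedekindDomain Field PowerSeries
  Literature.NumberTheory.EllipticCurves
  Literature.NumberTheory.EllipticCurves.ModularForms
  Literature.NumberTheory.EllipticCurves.Rank1Residual
  Literature.NumberTheory.EllipticCurves.Rank1Residual.Typed
  Literature.NumberTheory.EllipticCurves.KrizLi2019
  Literature.NumberTheory.GaloisRepresentations
  Literature.NumberTheory.GaloisCohomology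
  Summit.BirchSwinnertonDyer.Rank1Residual
  Summit.BirchSwinnertonDyer.Rank1Residual.Additive
  Summit.BirchSwinnertonDyer.Rank1Residual.X11b
  Summit.BirchSwinnertonDyer.Rank1Residual.X11b.AcSelmer
  Summit.BirchSwinnertonDyer.Rank1Residual.X11b.Halves
  Summit.BirchSwinnertonDyer.Rank1Residual.X11b.CongruenceLimit
  Summit.BirchSwinnertonDyer.BirchSwinnertonDyer.Theses.UniversalToricDescent
  Summit.BirchSwinnertonDyer.BirchSwinnertonDyer.Theorems.AdditivePotSupersingularControl

/-! ## §1 The rank-zero twist's UPPER half from Kato's Tamagawa-exact bound -/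

/-- **The r = 0 UPPER half of the Heegner twist of a tower-surjective additive potentially good curve, from Kato's
Tamagawa-exact reading.** For `W/ℚ` globally minimal, additive at the odd `p` with `ord_p j ≥ 0` and `ρ_{E,p^n}` onto for
every `n`, an imaginary quadratic `K` satisfying the Heegner hypothesis for `N(E)` (so `p` splits and `d_K ∈ (ℚ_p^×)²`), and a
globally minimal model `Wd` of `E^{(d_K)}` with `L(E^{(d_K)},1) ≠ 0`: `MissingUpperBoundAt Wd p`. Transport: `Wd` is additive
at `p` (`addv_iff_of_twist`), `j(Wd) = j(W)`, the tower of `Wd` is onto (`hasSurjectiveModNGaloisRep_pow_iff_of_model_twist`),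
hence `Wd[p]` irreducible and `X4RankZero.missingUpperBoundAt_of_katoTam` applies. CONDITIONAL on A161″, GZK, modularity.
[cite: Kato2004Asterisque, Thm. 14.5 (3) (p. 236), Prop. 14.16 (2) (p. 244), §14.8 (p. 238)]
[cite: GreenbergLNM1716, §4 Prop. 4.13] [cite: SilvermanAEC2009, X.5 Cor. 5.4] [cite: Serre1973, Ch. II §3.3 Thm. 3] -/
theorem missingUpperBoundAt_twist_of_towerSurj_of_katoTam (p : ℕ) [Fact p.Prime] (hp2 : p ≠ 2)
    (hKatoT : Kato2004.rankZero_padicValNat_sha_add_padicValNat_tamagawa_le_of_additive_potGood_of_imageContainsSL2)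
    (hGZK : rank_eq_analyticRank_of_analyticRank_le_one) (hmod : hasEntireLFunction_rat)
    (W : WeierstrassCurve ℚ) [W.IsElliptic] [W.IsGloballyMinimal] (haddv : Addv W p) (hj : 0 ≤ padicValRat p W.j)
    (hsurj : ∀ n : ℕ, W.HasSurjectiveModNGaloisRep (p ^ n : ℕ))
    {N : ℕ} (hN : W.conductorNorm ℤ = N) (K : Type) [Field K] [NumberField K] (hK : IsImaginaryQuadratic K)
    (hHN : SatisfiesHeegnerHypothesis N K) (Wd : WeierstrassCurve ℚ) [Wd.IsElliptic] [Wd.IsGloballyMinimal]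
    (hWd : ∃ C : VariableChange ℚ, C • W.quadraticTwist (NumberField.discr K : ℚ) = Wd)
    (hLd : (W.quadraticTwist (NumberField.discr K : ℚ)).entireLFunction 1 ≠ 0) : MissingUpperBoundAt Wd p := by
  have hp : p.Prime := Fact.out
  have hD0 : (NumberField.discr K : ℚ) ≠ 0 := by exact_mod_cast NumberField.discr_ne_zero K
  haveI : (W.quadraticTwist (NumberField.discr K : ℚ)).IsElliptic := W.isElliptic_quadraticTwist hD0
  obtain ⟨Cd, hCd⟩ := hWd
  have hpN : p ∣ N := by
    rw [← hN]; exact (W.dvd_conductorNorm_iff_not_hasGoodReductionAtPrime p).mpr (not_good_of_addv W p haddv)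
  -- `d_K` is a square in `ℚ_p` (Heegner: `p ∣ N` splits in `K`)
  have hsq' : IsSquare (algebraMap ℚ ℚ_[p] (NumberField.discr K : ℚ)) :=
    X11b.isSquare_discr_padic_of_heegner K hK hHN p hpN
  have hsq : IsSquare (((NumberField.discr K : ℚ) : ℚ) : ℚ_[p]) := by simpa using hsq'
  -- transport: additive at `p`, same `j`, same tower
  have haddvd : Addv Wd p := (AdditivePotMult.addv_iff_of_twist (W := W) hD0 hsq Wd hCd).mpr haddv
  have hjd : Wd.j = W.j := AdditivePotMult.j_of_model_twist (W := W) hD0 ⟨Cd, hCd⟩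
  have hsurjd : ∀ n : ℕ, Wd.HasSurjectiveModNGaloisRep (p ^ n : ℕ) := fun n ↦
    (GaloisImage.hasSurjectiveModNGaloisRep_pow_iff_of_model_twist W p hD0 ⟨Cd, hCd⟩ n).mpr (hsurj n)
  have hirrd : Wd.HasIrreducibleModPGaloisRep p := by
    have h1 := hsurjd 1
    simp only [pow_one] at h1
    haveI : NeZero (p : ℚ) := ⟨by exact_mod_cast hp.ne_zero⟩
    exact hasIrreducibleModPGaloisRep_of_hasSurjectiveModNGaloisRep Wd p (by exact_mod_cast h1)
  -- rank zero of the twist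
  have hLd1 : Wd.entireLFunction 1 ≠ 0 := by rw [← hCd, entireLFunction_smul]; exact hLd
  have hrd : Wd.analyticRank = 0 := analyticRank_eq_zero_of_entireLFunction_one_ne_zero Wd hLd1
  exact X4RankZero.missingUpperBoundAt_of_katoTam Wd p hKatoT hGZK hmod hrd ⟨hp2, haddvd, hirrd⟩ (by rw [hjd]; exact hj)
    hsurjd

section PotSS

variable (p : ℕ) [Fact p.Prime] (R : WeierstrassCurve ℚ → Prop)

/-! ## §2 The r = 1 LOWER half on the tower-surjective potentially supersingular rows: ONE research input -/

/-- **The r = 1 LOWER half at EVERY odd additive potentially SUPERSINGULAR prime on the TOWER-SURJECTIVE rows from the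
EISENSTEIN ♭-inclusion ALONE (modulo print).** For any row predicate `R`: on the rows `R W`, `ClassO5 W p ∨ ClassO6 W p`,
`ρ_{E,p^n}` onto for every `n`, `r_an = 1`: `MissingLowerBoundAt W p` ⟸ `hIncl` (X: `Ch_Λ(X_(∅,0) at 𝔭′)·𝓞_{ℂ_p}⟦T⟧ ⊆ (Q)` at
every Heegner datum and anticyclotomic frame of a class row — RESEARCH-GRADE, the only such input) ∧ Kato's A161″ ∧ GZK ∧
modularity ∧ {Poitou–Tate ×2, local Euler–Poincaré, cd ≤ 2, Brink Thm 2 / Cor 1, Serre 1967 §5 Prop 8} ∧ Hsieh 2014 Thm A ∧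
Liu–Zhang–Zhang 2018 ∧ ToricPublishedInputs. Control: `additiveControl_heegner_potSS_of_facts_of_serre1967`; the twist's
r = 0 upper half: `missingUpperBoundAt_twist_of_towerSurj_of_katoTam`. CONDITIONAL; closes nothing; BSD_p for no curve.
[cite: JetchevSkinnerWan2017, §7.4.1 and Thm. 3.3.1 (arXiv:1512.06894)] [cite: Kato2004Asterisque, Thm. 14.5 (3), Prop. 14.16 (2)]
[cite: Hsieh2014, Thm. A p. 712 (Doc. Math. 19)] [cite: LiuZhangZhang2018, Thm 1.5.1 and Thm 1.5.3 (Duke Math. J. 167 pp. 748–749)]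
[cite: Serre1967GroupesPDivisibles, §5 Prop. 8] [cite: GrossZagier1986, I.(6.3)] -/
theorem missingLowerBoundAt_potSS_towerSurj_of_flatEisenstein_of_katoTam_of_facts
    (hA : Hsieh2014.thmA_exists_isHsiehLFunction_unrPeriod_anyLevel)
    (hL : LiuZhangZhang2018.thm151_thm153_modularCurve_heegnerVector_additive)
    (hF : ToricPublishedInputs)
    (hKatoT : Kato2004.rankZero_padicValNat_sha_add_padicValNat_tamagawa_le_of_additive_potGood_of_imageContainsSL2)
    (hPT : ∀ (K : Type) [Field K] [NumberField K], poitouTate_selmerStructure_duality K)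
    (hPT2 : ∀ (K : Type) [Field K] [NumberField K], poitouTate_sha_tateDual K)
    (hEP : ∀ (K : Type) [Field K] [NumberField K] (v : HeightOneSpectrum (𝓞 K)),
      localEulerPoincareCharacteristic (v.adicCompletion K))
    (hcd : fieldCdLE_two_of_numberField)
    (hBr : ∀ (K : Type) [Field K] [NumberField K] (p : ℕ) [Fact p.Prime],
      ZpExtension.decomp_not_le_kerSubgroup_of_isAnticyclotomic K p)
    (hBr2 : ∀ (K : Type) [Field K] [NumberField K] (p : ℕ) [Fact p.Prime],
      ZpExtension.decomp_not_le_kerSubgroup_above_of_isAnticyclotomic K p)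
    (hS : Serre1967.noStableDivisibleLine_of_potentiallySupersingular)
    (hIncl : ∀ (W : WeierstrassCurve ℚ) [W.IsElliptic] [W.IsGloballyMinimal] (N : ℕ) [NeZero N] (K : Type) [Field K]
      [NumberField K] (Dt : ModularParametrizationData W N),
      R W → (ClassO5 W p ∨ ClassO6 W p) → (∀ n : ℕ, W.HasSurjectiveModNGaloisRep (p ^ n : ℕ)) → W.analyticRank = 1 →
      W.conductorNorm ℤ = N → IsImaginaryQuadratic K → SatisfiesHeegnerHypothesis N K →
      ∀ (κ : ZpExtension K p), κ.IsAnticyclotomic → ∀ (γ : Field.absoluteGaloisGroup K) [Fact (κ.IsTopGenerator γ)]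
        (𝔭 : HeightOneSpectrum (𝓞 K)), ((p : ℕ) : 𝓞 K) ∈ 𝔭.asIdeal → 𝔭.asIdeal.ramificationIdx (𝓞 ℚ) = 1 →
        𝔭.asIdeal.inertiaDeg (𝓞 ℚ) = 1 → ∀ (𝔭' : HeightOneSpectrum (𝓞 K)), ((p : ℕ) : 𝓞 K) ∈ 𝔭'.asIdeal → 𝔭' ≠ 𝔭 →
        ∀ (ι' : PadicAlgCl p ≃+* ℂ), SchneiderFree.BranchInducesPrime p ι' 𝔭 →
        ∀ (ΩK : ℂ) (Ωp : ℂ_[p]) (Q : PowerSeries (PadicComplexInt p)), ΩK ≠ 0 → Ωp ≠ 0 →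
          R1.IsBDPLFunctionInt p ι' 𝔭 κ γ Dt.f ΩK Ωp Q →
          (XAc.charIdeal (W.baseChange K) p κ 𝔭' ∅ γ).map (PowerSeries.map (R1.toCpInt p)) ≤ Ideal.span {Q}) :
    ∀ (W : WeierstrassCurve ℚ) [W.IsElliptic] [W.IsGloballyMinimal],
      R W → (ClassO5 W p ∨ ClassO6 W p) → (∀ n : ℕ, W.HasSurjectiveModNGaloisRep (p ^ n : ℕ)) → W.analyticRank = 1 →
        MissingLowerBoundAt W p := by
  intro W _ _ hR hcls hsurj hr
  have hp : p.Prime := Fact.out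
  have hp2 : p ≠ 2 := hcls.elim (fun h ↦ h.1) (fun h ↦ h.1)
  have haddv : Addv W p := hcls.elim (fun h ↦ h.2.1) (fun h ↦ h.2.1)
  have hj : 0 ≤ padicValRat p W.j := hcls.elim (fun h ↦ h.padicValRat_j_nonneg) (fun h ↦ h.padicValRat_j_nonneg)
  have hirr : W.HasIrreducibleModPGaloisRep p := by
    have h1 := hsurj 1
    simp only [pow_one] at h1
    haveI : NeZero (p : ℚ) := ⟨by exact_mod_cast hp.ne_zero⟩
    exact hasIrreducibleModPGaloisRep_of_hasSurjectiveModNGaloisRep W p (by exact_mod_cast h1)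
  have hGZK : rank_eq_analyticRank_of_analyticRank_le_one := hF.2.2.1
  have hmod : hasEntireLFunction_rat := hF.2.2.2.1
  exact missingLowerBoundAt_of_flatEisenstein_of_control_of_twistUpper_row p hp2 hA hL hF W haddv hr
    (fun N _ K _ _ Dt hN hK hHN κ hκ γ _ 𝔭 h𝔭 he hf 𝔭' h𝔭' hne ι' hind ΩK Ωp Q hΩK hΩp hBDP ↦
      hIncl W N K Dt hR hcls hsurj hr hN hK hHN κ hκ γ 𝔭 h𝔭 he hf 𝔭' h𝔭' hne ι' hind ΩK Ωp Q hΩK hΩp hBDP)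
    (fun N _ K _ _ Dt H ι P hN hK hHN _hLt hP hnt hKo κ hκ γ _ 𝔭 h𝔭 he hf ↦
      additiveControl_heegner_potSS_of_facts_of_serre1967 hPT hPT2 hEP hcd hBr hBr2 hS p W N K Dt H ι P hcls hirr
        hN hK hHN hP hnt hKo κ hκ γ 𝔭 h𝔭 he hf)
    (fun N _ K _ _ Wd _ _ hN hK hHN hC hLt ↦
      missingUpperBoundAt_twist_of_towerSurj_of_katoTam p hp2 hKatoT hGZK hmod W haddv hj hsurj hN K hK hHN Wd hC hLt)

/-! ## §3 BSD_p on the tower-surjective potentially supersingular rows: the IMC (or X + Ko) + the twist's LOWER half -/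

/-- **`BSD_p` in analytic rank one at EVERY odd additive potentially SUPERSINGULAR prime on the TOWER-SURJECTIVE rows from
the ♭-IMC EQUALITY and the twist's r = 0 LOWER half (modulo print).** Rows `R W`, `ClassO5 W p ∨ ClassO6 W p`, tower
onto, `r_an = 1`: `BSD_p(W)` ⟸ `hEq` (the ♭-(∅,0)-IMC equality at every class-row frame — RESEARCH) ∧ `hTwLo`
(`MissingLowerBoundAt` of globally minimal models of the rank-zero twists `E^{(d_K)}` of class rows — the r = 0 LOWER half,
K9 L₀ / KT L₀) ∧ A161″ ∧ the seven cohomological facts ∧ Hsieh ∧ LZZ ∧ ToricPublishedInputs. The twist's UPPER half and the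
local control are NOT hypotheses. CONDITIONAL; closes nothing; BSD_p for no curve.
[cite: JetchevSkinnerWan2017, §7.4.1 and Thm. 3.3.1 (arXiv:1512.06894)] [cite: Kato2004Asterisque, Thm. 14.5 (3), Prop. 14.16 (2)]
[cite: Hsieh2014, Thm. A p. 712 (Doc. Math. 19)] [cite: LiuZhangZhang2018, Thm 1.5.1 and Thm 1.5.3 (Duke Math. J. 167 pp. 748–749)]
[cite: Serre1967GroupesPDivisibles, §5 Prop. 8] [cite: GrossZagier1986, I.(6.3) and Thm. I.7.3] -/
theorem bsdp_potSS_towerSurj_of_flatIMCEq_of_twistLower_of_katoTam_of_facts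
    (hA : Hsieh2014.thmA_exists_isHsiehLFunction_unrPeriod_anyLevel)
    (hL : LiuZhangZhang2018.thm151_thm153_modularCurve_heegnerVector_additive)
    (hF : ToricPublishedInputs)
    (hKatoT : Kato2004.rankZero_padicValNat_sha_add_padicValNat_tamagawa_le_of_additive_potGood_of_imageContainsSL2)
    (hPT : ∀ (K : Type) [Field K] [NumberField K], poitouTate_selmerStructure_duality K)
    (hPT2 : ∀ (K : Type) [Field K] [NumberField K], poitouTate_sha_tateDual K)
    (hEP : ∀ (K : Type) [Field K] [NumberField K] (v : HeightOneSpectrum (𝓞 K)),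
      localEulerPoincareCharacteristic (v.adicCompletion K))
    (hcd : fieldCdLE_two_of_numberField)
    (hBr : ∀ (K : Type) [Field K] [NumberField K] (p : ℕ) [Fact p.Prime],
      ZpExtension.decomp_not_le_kerSubgroup_of_isAnticyclotomic K p)
    (hBr2 : ∀ (K : Type) [Field K] [NumberField K] (p : ℕ) [Fact p.Prime],
      ZpExtension.decomp_not_le_kerSubgroup_above_of_isAnticyclotomic K p)
    (hS : Serre1967.noStableDivisibleLine_of_potentiallySupersingular)
    (hEq : ∀ (W : WeierstrassCurve ℚ) [W.IsElliptic] [W.IsGloballyMinimal] (N : ℕ) [NeZero N] (K : Type) [Field K]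
      [NumberField K] (Dt : ModularParametrizationData W N),
      R W → (ClassO5 W p ∨ ClassO6 W p) → (∀ n : ℕ, W.HasSurjectiveModNGaloisRep (p ^ n : ℕ)) → W.analyticRank = 1 →
      W.conductorNorm ℤ = N → IsImaginaryQuadratic K → SatisfiesHeegnerHypothesis N K →
      ∀ (κ : ZpExtension K p), κ.IsAnticyclotomic → ∀ (γ : Field.absoluteGaloisGroup K) [Fact (κ.IsTopGenerator γ)]
        (𝔭 : HeightOneSpectrum (𝓞 K)), ((p : ℕ) : 𝓞 K) ∈ 𝔭.asIdeal → 𝔭.asIdeal.ramificationIdx (𝓞 ℚ) = 1 →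
        𝔭.asIdeal.inertiaDeg (𝓞 ℚ) = 1 → ∀ (𝔭' : HeightOneSpectrum (𝓞 K)), ((p : ℕ) : 𝓞 K) ∈ 𝔭'.asIdeal → 𝔭' ≠ 𝔭 →
        ∀ (ι' : PadicAlgCl p ≃+* ℂ), SchneiderFree.BranchInducesPrime p ι' 𝔭 →
        ∀ (ΩK : ℂ) (Ωp : ℂ_[p]) (Q : PowerSeries (PadicComplexInt p)), ΩK ≠ 0 → Ωp ≠ 0 →
          R1.IsBDPLFunctionInt p ι' 𝔭 κ γ Dt.f ΩK Ωp Q →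
          (XAc.charIdeal (W.baseChange K) p κ 𝔭' ∅ γ).map (PowerSeries.map (R1.toCpInt p)) = Ideal.span {Q})
    (hTwLo : ∀ (W : WeierstrassCurve ℚ) [W.IsElliptic] [W.IsGloballyMinimal] (N : ℕ) [NeZero N] (K : Type) [Field K]
      [NumberField K] (Wd : WeierstrassCurve ℚ) [Wd.IsElliptic] [Wd.IsGloballyMinimal],
      R W → (ClassO5 W p ∨ ClassO6 W p) → (∀ n : ℕ, W.HasSurjectiveModNGaloisRep (p ^ n : ℕ)) → W.analyticRank = 1 →
      W.conductorNorm ℤ = N → IsImaginaryQuadratic K → SatisfiesHeegnerHypothesis N K → Odd (NumberField.discr K) →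
      NumberField.discr K < -4 → (∃ C : VariableChange ℚ, C • W.quadraticTwist (NumberField.discr K : ℚ) = Wd) →
      (W.quadraticTwist (NumberField.discr K : ℚ)).entireLFunction 1 ≠ 0 → MissingLowerBoundAt Wd p) :
    ∀ (W : WeierstrassCurve ℚ) [W.IsElliptic] [W.IsGloballyMinimal],
      R W → (ClassO5 W p ∨ ClassO6 W p) → (∀ n : ℕ, W.HasSurjectiveModNGaloisRep (p ^ n : ℕ)) → W.analyticRank = 1 →
        BSDp W p := by
  intro W _ _ hR hcls hsurj hr
  have hp : p.Prime := Fact.out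
  have hp2 : p ≠ 2 := hcls.elim (fun h ↦ h.1) (fun h ↦ h.1)
  have haddv : Addv W p := hcls.elim (fun h ↦ h.2.1) (fun h ↦ h.2.1)
  have hj : 0 ≤ padicValRat p W.j := hcls.elim (fun h ↦ h.padicValRat_j_nonneg) (fun h ↦ h.padicValRat_j_nonneg)
  have hirr : W.HasIrreducibleModPGaloisRep p := by
    have h1 := hsurj 1
    simp only [pow_one] at h1
    haveI : NeZero (p : ℚ) := ⟨by exact_mod_cast hp.ne_zero⟩
    exact hasIrreducibleModPGaloisRep_of_hasSurjectiveModNGaloisRep W p (by exact_mod_cast h1)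
  have hGZK : rank_eq_analyticRank_of_analyticRank_le_one := hF.2.2.1
  have hmod : hasEntireLFunction_rat := hF.2.2.2.1
  have hKo : ∀ (N : ℕ) [NeZero N] (W : WeierstrassCurve ℚ) (K : Type) [Field K] [NumberField K],
      Literature.NumberTheory.EllipticCurves.kolyvagin N W K := hF.2.1
  -- control at every degree-one frame of every Heegner datum of `W`
  have hCtl : ∀ (N : ℕ) [NeZero N] (K : Type) [Field K] [NumberField K] (Dt : ModularParametrizationData W N)
      (H : HeegnerDatum N (NumberField.discr K)) (ι : K →+* ℂ) (P : (W.baseChange K).toAffine.Point),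
      W.conductorNorm ℤ = N → IsImaginaryQuadratic K → SatisfiesHeegnerHypothesis N K →
      WeierstrassCurve.Affine.Point.map ι.toRatAlgHom P = heegnerPointComplex Dt H → ¬ IsOfFinAddOrder P →
      Literature.NumberTheory.EllipticCurves.kolyvagin N W K →
      ∀ (κ : ZpExtension K p), κ.IsAnticyclotomic → ∀ (γ : Field.absoluteGaloisGroup K) [Fact (κ.IsTopGenerator γ)]
        (𝔭 : HeightOneSpectrum (𝓞 K)) (h𝔭 : ((p : ℕ) : 𝓞 K) ∈ 𝔭.asIdeal) (he : 𝔭.asIdeal.ramificationIdx (𝓞 ℚ) = 1)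
        (hf : 𝔭.asIdeal.inertiaDeg (𝓞 ℚ) = 1), SchneiderFree.AdditiveControlOnTreeAt p κ 𝔭 γ (embAt K p 𝔭 h𝔭 he hf) P :=
    fun N _ K _ _ Dt H ι P hN hK hHN hP hnt hKo' κ hκ γ _ 𝔭 h𝔭 he hf ↦
      additiveControl_heegner_potSS_of_facts_of_serre1967 hPT hPT2 hEP hcd hBr hBr2 hS p W N K Dt H ι P hcls hirr
        hN hK hHN hP hnt hKo' κ hκ γ 𝔭 h𝔭 he hf
  refine bsdp_of_indexHalves_of_twistHalvesOdd_row p hp2 hF W haddv hr ?_ ?_ ?_ ?_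
  · intro N _ K _ _ Dt H ι P hN hK hHN _hodd hd4 _hLt hP hnt
    exact indexLowerBoundLeAt_of_flatInclLe_of_control hp2 hA hL Dt H ι P haddv hN hK hHN hd4 hP hnt (hKo N W K)
      (fun κ hκ γ _ 𝔭 h𝔭 he hf 𝔭' h𝔭' hne ι' hind ΩK Ωp Q hΩK hΩp hBDP ↦
        (hEq W N K Dt hR hcls hsurj hr hN hK hHN κ hκ γ 𝔭 h𝔭 he hf 𝔭' h𝔭' hne ι' hind ΩK Ωp Q hΩK hΩp hBDP).le)
      (fun κ hκ γ _ 𝔭 h𝔭 he hf ↦ hCtl N K Dt H ι P hN hK hHN hP hnt (hKo N W K) κ hκ γ 𝔭 h𝔭 he hf)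
  · intro N _ K _ _ Dt H ι P hN hK hHN _hodd hd4 _hLt hP hnt
    exact indexUpperBoundLeAt_of_flatInclGe_of_control hp2 hA hL Dt H ι P haddv hN hK hHN hd4 hP hnt (hKo N W K)
      (fun κ hκ γ _ 𝔭 h𝔭 he hf 𝔭' h𝔭' hne ι' hind ΩK Ωp Q hΩK hΩp hBDP ↦
        (hEq W N K Dt hR hcls hsurj hr hN hK hHN κ hκ γ 𝔭 h𝔭 he hf 𝔭' h𝔭' hne ι' hind ΩK Ωp Q hΩK hΩp hBDP).ge)
      (fun κ hκ γ _ 𝔭 h𝔭 he hf ↦ hCtl N K Dt H ι P hN hK hHN hP hnt (hKo N W K) κ hκ γ 𝔭 h𝔭 he hf)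
  · intro N _ K _ _ Wd _ _ hN hK hHN hodd hd4 hC hLt
    exact hTwLo W N K Wd hR hcls hsurj hr hN hK hHN hodd hd4 hC hLt
  · intro N _ K _ _ Wd _ _ hN hK hHN _hodd _hd4 hC hLt
    exact missingUpperBoundAt_twist_of_towerSurj_of_katoTam p hp2 hKatoT hGZK hmod W haddv hj hsurj hN K hK hHN Wd hC hLt

/-- **The same with the Eisenstein ♭-inclusion (X) + a Manin-robust Kolyvagin index bound (Ko) in place of the equality**
(route SOED's shape, generic `p`, tower-surjective pot-ss rows): `BSD_p(W)` ⟸ `hIncl` ∧ `hKo` (`Upper.IndexUpperBoundLeAt W p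
K P (v_p c)` at every class-row Heegner datum with `d_K` odd `< −4`) ∧ `hTwLo` ∧ A161″ ∧ the named facts. CONDITIONAL.
[cite: JetchevSkinnerWan2017, §7.4.1 (arXiv:1512.06894 p. 30)] [cite: Jetchev2008, Thm. 1.4 and Conj. 1.3]
[cite: Kato2004Asterisque, Thm. 14.5 (3), Prop. 14.16 (2)] [cite: Serre1967GroupesPDivisibles, §5 Prop. 8] -/
theorem bsdp_potSS_towerSurj_of_flatEisenstein_of_kolyvagin_of_twistLower_of_katoTam_of_facts
    (hA : Hsieh2014.thmA_exists_isHsiehLFunction_unrPeriod_anyLevel)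
    (hL : LiuZhangZhang2018.thm151_thm153_modularCurve_heegnerVector_additive)
    (hF : ToricPublishedInputs)
    (hKatoT : Kato2004.rankZero_padicValNat_sha_add_padicValNat_tamagawa_le_of_additive_potGood_of_imageContainsSL2)
    (hPT : ∀ (K : Type) [Field K] [NumberField K], poitouTate_selmerStructure_duality K)
    (hPT2 : ∀ (K : Type) [Field K] [NumberField K], poitouTate_sha_tateDual K)
    (hEP : ∀ (K : Type) [Field K] [NumberField K] (v : HeightOneSpectrum (𝓞 K)),
      localEulerPoincareCharacteristic (v.adicCompletion K))
    (hcd : fieldCdLE_two_of_numberField)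
    (hBr : ∀ (K : Type) [Field K] [NumberField K] (p : ℕ) [Fact p.Prime],
      ZpExtension.decomp_not_le_kerSubgroup_of_isAnticyclotomic K p)
    (hBr2 : ∀ (K : Type) [Field K] [NumberField K] (p : ℕ) [Fact p.Prime],
      ZpExtension.decomp_not_le_kerSubgroup_above_of_isAnticyclotomic K p)
    (hS : Serre1967.noStableDivisibleLine_of_potentiallySupersingular)
    (hIncl : ∀ (W : WeierstrassCurve ℚ) [W.IsElliptic] [W.IsGloballyMinimal] (N : ℕ) [NeZero N] (K : Type) [Field K]
      [NumberField K] (Dt : ModularParametrizationData W N),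
      R W → (ClassO5 W p ∨ ClassO6 W p) → (∀ n : ℕ, W.HasSurjectiveModNGaloisRep (p ^ n : ℕ)) → W.analyticRank = 1 →
      W.conductorNorm ℤ = N → IsImaginaryQuadratic K → SatisfiesHeegnerHypothesis N K →
      ∀ (κ : ZpExtension K p), κ.IsAnticyclotomic → ∀ (γ : Field.absoluteGaloisGroup K) [Fact (κ.IsTopGenerator γ)]
        (𝔭 : HeightOneSpectrum (𝓞 K)), ((p : ℕ) : 𝓞 K) ∈ 𝔭.asIdeal → 𝔭.asIdeal.ramificationIdx (𝓞 ℚ) = 1 →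
        𝔭.asIdeal.inertiaDeg (𝓞 ℚ) = 1 → ∀ (𝔭' : HeightOneSpectrum (𝓞 K)), ((p : ℕ) : 𝓞 K) ∈ 𝔭'.asIdeal → 𝔭' ≠ 𝔭 →
        ∀ (ι' : PadicAlgCl p ≃+* ℂ), SchneiderFree.BranchInducesPrime p ι' 𝔭 →
        ∀ (ΩK : ℂ) (Ωp : ℂ_[p]) (Q : PowerSeries (PadicComplexInt p)), ΩK ≠ 0 → Ωp ≠ 0 →
          R1.IsBDPLFunctionInt p ι' 𝔭 κ γ Dt.f ΩK Ωp Q →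
          (XAc.charIdeal (W.baseChange K) p κ 𝔭' ∅ γ).map (PowerSeries.map (R1.toCpInt p)) ≤ Ideal.span {Q})
    (hKo : ∀ (W : WeierstrassCurve ℚ) [W.IsElliptic] [W.IsGloballyMinimal] (N : ℕ) [NeZero N] (K : Type) [Field K]
      [NumberField K] (Dt : ModularParametrizationData W N) (H : HeegnerDatum N (NumberField.discr K)) (ι : K →+* ℂ)
      (P : (W.baseChange K).toAffine.Point),
      R W → (ClassO5 W p ∨ ClassO6 W p) → (∀ n : ℕ, W.HasSurjectiveModNGaloisRep (p ^ n : ℕ)) → W.analyticRank = 1 →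
      W.conductorNorm ℤ = N → IsImaginaryQuadratic K → SatisfiesHeegnerHypothesis N K → Odd (NumberField.discr K) →
      NumberField.discr K < -4 → (W.quadraticTwist (NumberField.discr K : ℚ)).entireLFunction 1 ≠ 0 →
      WeierstrassCurve.Affine.Point.map ι.toRatAlgHom P = heegnerPointComplex Dt H → ¬ IsOfFinAddOrder P →
      SchneiderFree.Upper.IndexUpperBoundLeAt W p K P (padicValNat p Dt.c.natAbs))
    (hTwLo : ∀ (W : WeierstrassCurve ℚ) [W.IsElliptic] [W.IsGloballyMinimal] (N : ℕ) [NeZero N] (K : Type) [Field K]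
      [NumberField K] (Wd : WeierstrassCurve ℚ) [Wd.IsElliptic] [Wd.IsGloballyMinimal],
      R W → (ClassO5 W p ∨ ClassO6 W p) → (∀ n : ℕ, W.HasSurjectiveModNGaloisRep (p ^ n : ℕ)) → W.analyticRank = 1 →
      W.conductorNorm ℤ = N → IsImaginaryQuadratic K → SatisfiesHeegnerHypothesis N K → Odd (NumberField.discr K) →
      NumberField.discr K < -4 → (∃ C : VariableChange ℚ, C • W.quadraticTwist (NumberField.discr K : ℚ) = Wd) →
      (W.quadraticTwist (NumberField.discr K : ℚ)).entireLFunction 1 ≠ 0 → MissingLowerBoundAt Wd p) :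
    ∀ (W : WeierstrassCurve ℚ) [W.IsElliptic] [W.IsGloballyMinimal],
      R W → (ClassO5 W p ∨ ClassO6 W p) → (∀ n : ℕ, W.HasSurjectiveModNGaloisRep (p ^ n : ℕ)) → W.analyticRank = 1 →
        BSDp W p := by
  intro W _ _ hR hcls hsurj hr
  have hp : p.Prime := Fact.out
  have hp2 : p ≠ 2 := hcls.elim (fun h ↦ h.1) (fun h ↦ h.1)
  have haddv : Addv W p := hcls.elim (fun h ↦ h.2.1) (fun h ↦ h.2.1)
  have hj : 0 ≤ padicValRat p W.j := hcls.elim (fun h ↦ h.padicValRat_j_nonneg) (fun h ↦ h.padicValRat_j_nonneg)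
  have hirr : W.HasIrreducibleModPGaloisRep p := by
    have h1 := hsurj 1
    simp only [pow_one] at h1
    haveI : NeZero (p : ℚ) := ⟨by exact_mod_cast hp.ne_zero⟩
    exact hasIrreducibleModPGaloisRep_of_hasSurjectiveModNGaloisRep W p (by exact_mod_cast h1)
  have hGZK : rank_eq_analyticRank_of_analyticRank_le_one := hF.2.2.1
  have hmod : hasEntireLFunction_rat := hF.2.2.2.1
  have hKo' : ∀ (N : ℕ) [NeZero N] (W : WeierstrassCurve ℚ) (K : Type) [Field K] [NumberField K],
      Literature.NumberTheory.EllipticCurves.kolyvagin N W K := hF.2.1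
  refine bsdp_of_indexHalves_of_twistHalvesOdd_row p hp2 hF W haddv hr ?_ ?_ ?_ ?_
  · intro N _ K _ _ Dt H ι P hN hK hHN _hodd hd4 _hLt hP hnt
    exact indexLowerBoundLeAt_of_flatInclLe_of_control hp2 hA hL Dt H ι P haddv hN hK hHN hd4 hP hnt (hKo' N W K)
      (fun κ hκ γ _ 𝔭 h𝔭 he hf 𝔭' h𝔭' hne ι' hind ΩK Ωp Q hΩK hΩp hBDP ↦
        hIncl W N K Dt hR hcls hsurj hr hN hK hHN κ hκ γ 𝔭 h𝔭 he hf 𝔭' h𝔭' hne ι' hind ΩK Ωp Q hΩK hΩp hBDP)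
      (fun κ hκ γ _ 𝔭 h𝔭 he hf ↦
        additiveControl_heegner_potSS_of_facts_of_serre1967 hPT hPT2 hEP hcd hBr hBr2 hS p W N K Dt H ι P hcls hirr
          hN hK hHN hP hnt (hKo' N W K) κ hκ γ 𝔭 h𝔭 he hf)
  · intro N _ K _ _ Dt H ι P hN hK hHN hodd hd4 hLt hP hnt
    exact hKo W N K Dt H ι P hR hcls hsurj hr hN hK hHN hodd hd4 hLt hP hnt
  · intro N _ K _ _ Wd _ _ hN hK hHN hodd hd4 hC hLt
    exact hTwLo W N K Wd hR hcls hsurj hr hN hK hHN hodd hd4 hC hLt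
  · intro N _ K _ _ Wd _ _ hN hK hHN _hodd _hd4 hC hLt
    exact missingUpperBoundAt_twist_of_towerSurj_of_katoTam p hp2 hKatoT hGZK hmod W haddv hj hsurj hN K hK hHN Wd hC hLt

end PotSS

end Summit.BirchSwinnertonDyer.BirchSwinnertonDyer.Theorems.UniversalToricDescentWaldspurgerFlat

end
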